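import Literature.AlgebraicGeometry.Motives.HyperbolicWeilType
import HarnessLib

/-!
# Weil-similar pairs: rational models of `H¹` with the same matrices

Topic `Literature/AlgebraicGeometry/Motives`. A DEFINITION file (nothing is asserted).

Let `K = ℚ(√-d)` and let `(P, ψ)`, `(A, φ)` be complex abelian `2n`-folds with `ψ ≫ ψ = -d`,
`φ ≫ φ = -d`, with polarization classes `h_P ∈ H²(P(ℂ); ℂ)`, `h_A ∈ H²(A(ℂ); ℂ)`. Deligne's moduli
problem for polarized abelian varieties with `K`-multiplication [Deligne 1982, proof of Thm. 4.8,
pp. 48–51 of LNM 900] parametrises quadruples `(A₁, θ₁, ν₁, k₁)` where `k₁ : H₁(A₁, ℚ) ≅ H` is a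
`K`-LINEAR isomorphism "carrying a Riemann form for `θ₁` into `cψ` for some `c ∈ ℚ^×`" (loc. cit.
p. 48, verbatim); two abelian varieties with `K`-multiplication whose rational `H₁`'s are related by
such a `k₁` lie, up to `K`-isogeny, over the same PEL moduli space (components `Γ \ X^±`, loc. cit.
pp. 50–51 and Remark 4.9).

This file renders the relation "there is a `K`-linear isomorphism `H¹(P, ℚ) ≅ H¹(A, ℚ)` carrying the
polarization form of `h_P` to a `ℚ^×`-multiple of that of `h_A`" on the tree's REAL CARRIERS, in the
idiom of RATIONAL MODELS already used by `Motives.IsHyperbolicWeilType` (a rational `φ^*`-stable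
isotropic frame) and by `Motives.isHyperbolicWeilType_prod_of_rationalModels` (frames `u` with a
rational matrix `M` for `φ^*`, a rational Gram matrix `G` of `polarizationPairingOne _ h j` relative to
a rational top class `ω`):

* `IsWeilSimilar n P ψ hP A φ hA`: there are rational, `ℂ`-linearly independent `4n`-frames `u` of
  `H¹(P(ℂ); ℂ)` and `v` of `H¹(A(ℂ); ℂ)`, ONE rational matrix `M` with `ψ^* uᵢ = Σⱼ Mⱼᵢ uⱼ` and
  `φ^* vᵢ = Σⱼ Mⱼᵢ vⱼ`, and ONE rational matrix `G` with `h_P^{2n-1} ⌣ uᵢ ⌣ uⱼ = Gᵢⱼ · ω_P` and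
  `h_A^{2n-1} ⌣ vᵢ ⌣ vⱼ = Gᵢⱼ · ω_A` for some non-zero rational top-degree classes `ω_P`, `ω_A`.

Dictionary (intended regime `P.dim = A.dim = 2n`, so `b₁ = 4n` and `b_{4n} = 1`): `u`, `v` are
`ℚ`-bases of `H¹(·, ℚ)`; `uᵢ ↦ vᵢ` is a `ℚ`-linear isomorphism `k : H¹(P, ℚ) → H¹(A, ℚ)` with
`k ∘ ψ^* = φ^* ∘ k`, i.e. `K`-linear for `√-d ↦ ψ^*, φ^*`; under the degree isomorphisms
`H^{4n}(·, ℚ) ≅ ℚ` the Gram identities say `Q_{h_A}(k x, k y) = c · Q_{h_P}(x, y)` with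
`c = deg ω_A / deg ω_P ∈ ℚ^×`; and `Q_{h, 2n-1}` on `H¹` is a non-zero rational multiple of the form
dual to the Riemann form of `h` on `H₁` [Birkenhake–Lange, Lemma 1.7.4; docstring of
`polarizationPairingOne`]. So `IsWeilSimilar` is exactly Deligne's "`k₁` is `E`-linear and carries a
Riemann form into `cψ`, `c ∈ ℚ^×`" between the two members, transposed to cohomology. By Lemma 4.6 of
loc. cit. (the Riemann form determines the `K`-Hermitian form `ϕ` with `ψ = Tr_{K/ℚ}(f ϕ)`), it says
that van Geemen's Hermitian forms `H_P`, `H_A` [van Geemen 1994, Lemma 5.2] are SIMILAR (isometric up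
to the factor `c ∈ ℚ^×`); for forms of even rank `2n` and signature `(n, n)` similarity and isometry
classes coincide [Deligne 1982, Prop. 4.1 (Landherr): the invariants are the signatures and
`disc ∈ ℚ^× / N(K^×)`, and `disc(cH) = c^{2n} disc(H)`].

The relation is symmetric (`IsWeilSimilar.symm`) and insensitive to rescaling either polarization
class by a non-zero rational (`IsWeilSimilar.smul_right`, `IsWeilSimilar.smul_left`; a polarization
class is only defined up to `ℚ^×_{>0}` anyway, and the carriers do not see the sign). Two HYPERBOLIC
members (`IsHyperbolicWeilType` on both sides) are Weil-similar by the standard hyperbolic bases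
[Deligne 1982, proof of Cor. 4.2] — a statement of linear algebra over `K` plus the non-degeneracy of
`Q_{h,2n-1}` on `H¹` and `b_{4n} = 1`, left to the theorem layer.

## References
* [Deligne1982HodgeCycles] P. Deligne, Hodge cycles on abelian varieties, in LNM 900 (1982): §4,
  Prop. 4.1, Cor. 4.2, Lemma 4.6, proof of Thm. 4.8 (pp. 47–52), Remark 4.9.
* [vanGeemen1994HodgeAV] B. van Geemen, An introduction to the Hodge conjecture for abelian
  varieties, LNM 1594 (1994): Lemma 5.2, 5.3–5.4.
* [LangeBirkenhake1992] H. Lange, Ch. Birkenhake, Complex abelian varieties (1992): Lemma 1.7.4.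
* [Landherr1936HermitianForms] W. Landherr, Äquivalenz Hermitescher Formen über einem beliebigen
  algebraischen Zahlkörper, Abh. Math. Sem. Hamburg 11 (1936).
-/

noncomputable section

open CategoryTheory
open Literature.AlgebraicTopology.SingularHomology
open Literature.AlgebraicGeometry.HodgeTheory
open Literature.Geometry.Kaehler

namespace Literature.AlgebraicGeometry.Motives

/-- **`(P, ψ, h_P)` and `(A, φ, h_A)` are Weil-similar in half-dimension `n`**: there are rational,
`ℂ`-linearly independent `4n`-frames `u` of `H¹(P(ℂ); ℂ)` and `v` of `H¹(A(ℂ); ℂ)` in which `ψ^*`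
and `φ^*` have the SAME rational matrix `M` (`ψ^* uᵢ = Σⱼ Mⱼᵢ uⱼ`, `φ^* vᵢ = Σⱼ Mⱼᵢ vⱼ`) and the
polarization pairings `Q_{h_P, 2n-1}`, `Q_{h_A, 2n-1}` (`polarizationPairingOne`) have the SAME
rational Gram matrix `G` relative to non-zero rational top-degree classes `ω_P`, `ω_A`
(`Q(uᵢ, uⱼ) = Gᵢⱼ ω_P`, `Q(vᵢ, vⱼ) = Gᵢⱼ ω_A`). In the regime `P.dim = A.dim = 2n`: a `K`-linear
isomorphism `H¹(P, ℚ) ≅ H¹(A, ℚ)` (`K = ℚ(√-d)` acting by `ψ^*`, `φ^*`) carrying the polarization form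
of `h_P` to a `ℚ^×`-multiple of that of `h_A` — Deligne's condition on the marking `k₁` of a point of
the PEL moduli problem ("carrying a Riemann form for `θ₁` into `cψ` for some `c ∈ ℚ^×`"), transposed
to cohomology; equivalently (Lemma 4.6) the `K`-Hermitian forms of van Geemen's Lemma 5.2 are similar.
Vacuous bookkeeping for `n = 0`. [cite: Deligne1982HodgeCycles, proof of Thm. 4.8 (p. 48: the quadruples (A₁, θ₁, ν₁, k₁)) and Lemma 4.6]
[cite: vanGeemen1994HodgeAV, Lemma 5.2] -/
def IsWeilSimilar (n : ℕ) (P : AbelianVariety ℂ) (ψ : P ⟶ P) (hP : complexBetti P.X 2)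
    (A : AbelianVariety ℂ) (φ : A ⟶ A) (hA : complexBetti A.X 2) : Prop :=
  ∃ (u : Fin (4 * n) → complexBetti P.X 1) (v : Fin (4 * n) → complexBetti A.X 1)
    (M G : Matrix (Fin (4 * n)) (Fin (4 * n)) ℚ)
    (ωP : complexBetti P.X (2 + 2 * (2 * n - 1))) (ωA : complexBetti A.X (2 + 2 * (2 * n - 1))),
    (∀ i, IsRationalClass (u i)) ∧ LinearIndependent ℂ u ∧
    (∀ i, IsRationalClass (v i)) ∧ LinearIndependent ℂ v ∧
    (∀ i, complexBetti.map ψ.hom.hom.hom 1 (u i) = ∑ j, ((M j i : ℚ) : ℂ) • u j) ∧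
    (∀ i, complexBetti.map φ.hom.hom.hom 1 (v i) = ∑ j, ((M j i : ℚ) : ℂ) • v j) ∧
    IsRationalClass ωP ∧ ωP ≠ 0 ∧ IsRationalClass ωA ∧ ωA ≠ 0 ∧
    (∀ i j, polarizationPairingOne P.X hP (2 * n - 1) (u i) (u j) = ((G i j : ℚ) : ℂ) • ωP) ∧
    (∀ i j, polarizationPairingOne A.X hA (2 * n - 1) (v i) (v j) = ((G i j : ℚ) : ℂ) • ωA)

variable {n : ℕ} {P : AbelianVariety ℂ} {ψ : P ⟶ P} {hP : complexBetti P.X 2}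
  {A : AbelianVariety ℂ} {φ : A ⟶ A} {hA : complexBetti A.X 2}

/-- Unfolding `IsWeilSimilar` (definitional). [cite: Deligne1982HodgeCycles, proof of Thm. 4.8 (p. 48)] -/
theorem isWeilSimilar_iff :
    IsWeilSimilar n P ψ hP A φ hA ↔
      ∃ (u : Fin (4 * n) → complexBetti P.X 1) (v : Fin (4 * n) → complexBetti A.X 1)
        (M G : Matrix (Fin (4 * n)) (Fin (4 * n)) ℚ)
        (ωP : complexBetti P.X (2 + 2 * (2 * n - 1)))
        (ωA : complexBetti A.X (2 + 2 * (2 * n - 1))),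
        (∀ i, IsRationalClass (u i)) ∧ LinearIndependent ℂ u ∧
        (∀ i, IsRationalClass (v i)) ∧ LinearIndependent ℂ v ∧
        (∀ i, complexBetti.map ψ.hom.hom.hom 1 (u i) = ∑ j, ((M j i : ℚ) : ℂ) • u j) ∧
        (∀ i, complexBetti.map φ.hom.hom.hom 1 (v i) = ∑ j, ((M j i : ℚ) : ℂ) • v j) ∧
        IsRationalClass ωP ∧ ωP ≠ 0 ∧ IsRationalClass ωA ∧ ωA ≠ 0 ∧
        (∀ i j, polarizationPairingOne P.X hP (2 * n - 1) (u i) (u j) = ((G i j : ℚ) : ℂ) • ωP) ∧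
        (∀ i j, polarizationPairingOne A.X hA (2 * n - 1) (v i) (v j) = ((G i j : ℚ) : ℂ) • ωA) :=
  Iff.rfl

/-- Weil-similarity is symmetric (swap the two rational models). [folklore] -/
theorem IsWeilSimilar.symm (h : IsWeilSimilar n P ψ hP A φ hA) : IsWeilSimilar n A φ hA P ψ hP := by
  obtain ⟨u, v, M, G, ωP, ωA, hu, hui, hv, hvi, hMu, hMv, hωP, hωP0, hωA, hωA0, hGu, hGv⟩ := h
  exact ⟨v, u, M, G, ωA, ωP, hv, hvi, hu, hui, hMv, hMu, hωA, hωA0, hωP, hωP0, hGv, hGu⟩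

/-- Weil-similarity is insensitive to rescaling the second polarization class by a non-zero
rational: `Q_{c h, j} = cʲ Q_{h, j}` (`polarizationPairingOne_smul`), so the same Gram matrix `G`
works relative to the rational top class `cʲ ω_A`. [folklore] -/
theorem IsWeilSimilar.smul_right (h : IsWeilSimilar n P ψ hP A φ hA) (c : ℚ) (hc : c ≠ 0) :
    IsWeilSimilar n P ψ hP A φ ((c : ℂ) • hA) := by
  obtain ⟨u, v, M, G, ωP, ωA, hu, hui, hv, hvi, hMu, hMv, hωP, hωP0, hωA, hωA0, hGu, hGv⟩ := h
  refine ⟨u, v, M, G, ωP, ((c ^ (2 * n - 1) : ℚ) : ℂ) • ωA, hu, hui, hv, hvi, hMu, hMv, hωP, hωP0,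
    hωA.smul _, ?_, hGu, fun i j => ?_⟩
  · exact smul_ne_zero (by exact_mod_cast pow_ne_zero _ hc) hωA0
  · rw [polarizationPairingOne_smul, hGv i j, smul_comm, Rat.cast_pow]

/-- Weil-similarity is insensitive to rescaling the first polarization class by a non-zero rational.
[folklore] -/
theorem IsWeilSimilar.smul_left (h : IsWeilSimilar n P ψ hP A φ hA) (c : ℚ) (hc : c ≠ 0) :
    IsWeilSimilar n P ψ ((c : ℂ) • hP) A φ hA :=
  (h.symm.smul_right c hc).symm

end Literature.AlgebraicGeometry.Motives

end
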